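import Summits.Ventures.GridStability.Models.SMIBLff
import Summits.Ventures.GridStability.Models.InverterInstances

/-!
# GridStability/Models/InverterDroopLFFRoa — rung G3.a: a SECOND certified region for «GFM-SMIB-QoriaV4», solver-free, from Vu–Turitsyn's closed-form Lyapunov functions family, read on the droop grid-forming converter model

Cell `gridfusion` (LADDER-GRIDFUSION, APEX LINE rung G3.a; lit-6 01:35:11Z «a second certified region
(beside the energy well) for InverterDroopRoa's instance of record … n = 1, E = [1], pick
c/c′ = d/m·(1 − margin); the LFF well is larger in the speed direction … their UNION is certified»);
seat gridfusion-model-3 (g4). Instance companion of `Models/SMIBLff.lean` (generic lossless SMIB ↔ LFF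
bridge and `SMIB.lff_roa`) at the G3.a instance of record `InverterDroop.gfmSmibQoriaV4` (p469363) via
model-3's exact bridge `ReducedParams.toGridSMIB` / `isSolutionOn_toGridSMIB` (p462458). Beside the SOS
regions (deg 2 level 55, p471944; deg 4 level 21/4, p487839) and lit-6's energy well (p467107), this is
the THIRD kind of certified region for the same model and equilibrium — and it needs NO semidefinite
programming: every hypothesis is a scalar inequality on the typed rationals.

THE CERTIFIED FAMILY (weight `c ∈ (0, 33)`, `c′ = 1`; `33 = D/M = ω_c` is the instance's ratio):
`gain_c(u, Ω) = ½((3729/3550)·c·u² + 2·(113/3550)·c·u·Ω + (113/3550)·Ω²)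
               + 4·(16451071/16581121 − cos(δ^s + u) − u·2072640/16581121)`
(`u = δ − δ^s`, `Ω = ω_b′(ω − ω_e)` [rad/s]; `= energy function + c·(M u Ω + ½ D u²)`, `lffGain_eq_energy`),
and for every level `ℓ < 4·vtGap(δ^s)` — in particular every `ℓ ≤ 649/100` (`level_649_admissible`:
`4·vtGap(δ^s) > 6.49` from `π < 3.1416`, `δ^s ≥ sin δ^s`) — the set
`{(δ, ω) : |δ + δ^s| < π, gain_c(δ − δ^s, ω_b′(ω − ω_e)) ≤ ℓ}` is positively invariant along the
model's solutions and every solution from it has `δ → δ^s`, `ω → ω_e`. For `c → 0` the sets shrink to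
the energy well; for `c > 0` they contain states with energy ABOVE the separatrix value `4·vtGap(δ^s)`
whenever `u·(M Ω + ½ D u) < 0` (returning fast enough) — the «larger in the speed direction» of lit-6's
line; the UNION over `c` and over the SOS regions is certified.

THREE COLUMNS. CERTIFIED (kernel, this file + `SMIBLff` + lit-6 p479780/p483522): the region statements
for the MODEL. MODELLED: the reduced droop-GFM converter model «GFM-SMIB-QoriaV4» =
`InverterDroop.gfmSmibQoriaV4` ([cite: Qoria2020, (III-46)+(V-13), §V.4]; MODEL-VALIDITY MV-6D + MV-P +
MV-Ω(ω_b′ = 35500/113); current limitation, TVR/virtual impedance, inner loops, line dynamics ABSENT) ≡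
lossless classical SMIB (`toGridSMIB`: `M = 113/3550`, `D = 3729/3550`, `P_M = 4`, `P_C = 0`, `γ = 0`).
VALIDATED: nothing. Inner estimates; no sentence of this file says a converter or a grid is stable.
-/

noncomputable section

open Real Set Filter Topology
open Literature.MathematicalPhysics.PowerSystems.ClassicalModel.LosslessSystem (vtGap)

namespace Summit.Ventures.GridStability.Models.InverterDroop.gfmSmibQoriaV4

open Models.SMIB (lffState lffCert)

/-! ## §1 Data facts of the equivalent SMIB record -/

/-- `P_M = P_max = 4`. -/
theorem toGridSMIB_PM : gfmSmibQoriaV4.toGridSMIB.PM = 4 := by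
  norm_num [ReducedParams.toGridSMIB, gfmSmibQoriaV4]

/-- `P_C = 0` (lossless coupling, no local load). -/
theorem toGridSMIB_PC : gfmSmibQoriaV4.toGridSMIB.PC = 0 := rfl

/-- `γ = 0`. -/
theorem toGridSMIB_γ : gfmSmibQoriaV4.toGridSMIB.γ = 0 := rfl

/-- `M = 113/3550 > 0`. -/
theorem toGridSMIB_M_pos : 0 < gfmSmibQoriaV4.toGridSMIB.M := by rw [toGridSMIB_M]; norm_num

/-- `D = 3729/3550 > 0`. -/
theorem toGridSMIB_D_pos : 0 < gfmSmibQoriaV4.toGridSMIB.D := by rw [toGridSMIB_D]; norm_num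

/-- `P_M = 4 > 0`. -/
theorem toGridSMIB_PM_pos : 0 < gfmSmibQoriaV4.toGridSMIB.PM := by rw [toGridSMIB_PM]; norm_num

/-- `δ^s` is an equilibrium angle of the equivalent SMIB record (power balance, p469363). -/
theorem isEquilibrium_toGridSMIB : gfmSmibQoriaV4.toGridSMIB.IsEquilibrium gfmSmibQoriaV4_δs :=
  (gfmSmibQoriaV4.isEquilibrium_toGridSMIB_iff _).2 power_balance

/-- `0 < δ^s` (`δ^s = arcsin(2072640/16581121)`). -/
theorem δs_pos : 0 < gfmSmibQoriaV4_δs := by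
  unfold gfmSmibQoriaV4_δs
  exact Real.arcsin_pos.2 (by norm_num)

/-- `δ^s < π/2`. -/
theorem δs_lt : gfmSmibQoriaV4_δs < π / 2 := by
  unfold gfmSmibQoriaV4_δs
  exact Real.arcsin_lt_pi_div_two.2 (by norm_num)

/-- `|δ^s| < π/2` (Vu–Turitsyn's standing hypothesis on the equilibrium line angle). -/
theorem abs_δs_lt : |gfmSmibQoriaV4_δs| < π / 2 := by
  rw [abs_of_pos δs_pos]; exact δs_lt

/-- `sin δ^s ≤ δ^s`, i.e. `δ^s ≥ 2072640/16581121`. -/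
theorem sin_δs_le : (2072640 : ℝ) / 16581121 ≤ gfmSmibQoriaV4_δs := by
  rw [← sin_gfmSmibQoriaV4_δs]; exact Real.sin_le δs_pos.le

/-- The weight condition `c·M < c′·D` of the closed-form member, for `c′ = 1`: `c < 33 = D/M = ω_c`. -/
theorem weight_lt {c : ℝ} (hc33 : c < 33) :
    c * gfmSmibQoriaV4.toGridSMIB.M < 1 * gfmSmibQoriaV4.toGridSMIB.D := by
  rw [toGridSMIB_M, toGridSMIB_D]; nlinarith

/-! ## §2 The certified Lyapunov gain, in closed form on the converter's deviation coordinates -/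

/-- The GAIN `V − V(0)` of the closed-form LFF member with weights `(c, 1)` for «GFM-SMIB-QoriaV4», in
the deviation coordinates `u = δ − δ^s`, `Ω = ω_b′(ω − ω_e)`:
`½((3729/3550)c u² + 2(113/3550)c u Ω + (113/3550)Ω²) + 4(16451071/16581121 − cos(δ^s + u) − u·2072640/16581121)`.
MODELLED: MV-6D + MV-P + MV-Ω. [cite: VuTuritsyn2016, §III eq. (Lyapunov)] -/
def lffGain (c u Ω : ℝ) : ℝ :=
  1 / 2 * ((3729 : ℝ) / 3550 * c * u ^ 2 + 2 * ((113 : ℝ) / 3550 * c) * u * Ω + (113 : ℝ) / 3550 * Ω ^ 2)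
    + 4 * ((16451071 : ℝ) / 16581121 - cos (gfmSmibQoriaV4_δs + u) - u * ((2072640 : ℝ) / 16581121))

/-- `lffGain c` IS the gain of the kernel certificate `SMIB.lffCert` of the equivalent record (weights
`(c, 1)`) at the LFF state of `(δ, Ω)`. [folklore] -/
theorem lffGain_eq_certificate {c : ℝ} (hc : 0 < c) (hc33 : c < 33) (x : ℝ × ℝ) :
    (gfmSmibQoriaV4.toGridSMIB.lffCert gfmSmibQoriaV4_δs toGridSMIB_M_pos toGridSMIB_D_pos
        toGridSMIB_PM_pos hc one_pos (weight_lt hc33)).V (lffState gfmSmibQoriaV4_δs x)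
      - (gfmSmibQoriaV4.toGridSMIB.lffCert gfmSmibQoriaV4_δs toGridSMIB_M_pos toGridSMIB_D_pos
        toGridSMIB_PM_pos hc one_pos (weight_lt hc33)).V 0
      = lffGain c (x.1 - gfmSmibQoriaV4_δs) x.2 := by
  rw [Models.SMIB.lffGain_eq, toGridSMIB_M, toGridSMIB_D, toGridSMIB_PM, cos_gfmSmibQoriaV4_δs,
    sin_gfmSmibQoriaV4_δs, lffGain, show gfmSmibQoriaV4_δs + (x.1 - gfmSmibQoriaV4_δs) = x.1 by ring]
  ring

/-- The gain is the model's ENERGY FUNCTION gain plus `c` times the cross term `M u Ω + ½ D u²`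
(`M = 113/3550`, `D = 3729/3550`): for `c → 0` the certified sets shrink to the energy well, for
`c > 0` they reach beyond it where `u(MΩ + ½Du) < 0`. [folklore] -/
theorem lffGain_eq_energy (c u Ω : ℝ) :
    lffGain c u Ω = ((113 : ℝ) / 3550 * Ω ^ 2 / 2
        + 4 * ((16451071 : ℝ) / 16581121 - cos (gfmSmibQoriaV4_δs + u) - u * ((2072640 : ℝ) / 16581121)))
      + c * ((113 : ℝ) / 3550 * u * Ω + (3729 : ℝ) / 3550 * u ^ 2 / 2) := by
  unfold lffGain; ring

/-- **A rational admissible level**: `649/100 < 4·vtGap(δ^s)` (`vtGap δ = 2cos δ − (π − 2|δ|) sin|δ|`;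
from `cos δ^s = 16451071/16581121`, `sin δ^s = 2072640/16581121 ≤ δ^s`, `π < 3.1416`). [folklore] -/
theorem level_649_admissible : (649 : ℝ) / 100 < 1 * gfmSmibQoriaV4.toGridSMIB.PM * vtGap gfmSmibQoriaV4_δs := by
  rw [toGridSMIB_PM, vtGap, abs_of_pos δs_pos, cos_gfmSmibQoriaV4_δs, sin_gfmSmibQoriaV4_δs]
  have hπ := Real.pi_lt_d4
  have hδ := sin_δs_le
  nlinarith

/-! ## §3 The certified regions on the converter model (hypothesis-free; one for each weight `c`) -/

/-- **Rung G3.a — LFF closed-form region of attraction of «GFM-SMIB-QoriaV4», solver-free, read on the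
droop grid-forming converter model.** For every weight `0 < c < 33`, every level `ℓ < 4·vtGap(δ^s)`
and EVERY solution `(δ, ω)` of `InverterDroop.gfmSmibQoriaV4` (derivatives at all times) with
`|δ(0) + δ^s| < π` and `lffGain c (δ 0 − δ^s) (ω_b′(ω 0 − ω_e)) ≤ ℓ`: for all `t ≥ 0`,
`|δ t + δ^s| < π` and the gain stays `≤ ℓ` (positive invariance of the well), and
`(δ t, ω_b′(ω t − ω_e)) → (δ^s, 0)`. Transport of `SMIB.lff_roa` along `toGridSMIB` (p462458) with the
instance's kernel data facts. CERTIFIED for the MODEL; MODELLED: MV-6D + MV-P + MV-Ω; inner estimate;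
no sentence here says a converter is stable. [cite: VuTuritsyn2016, §IV (set ℛ, third construction)] -/
theorem lff_roa {c : ℝ} (hc : 0 < c) (hc33 : c < 33) {ℓ : ℝ}
    (hℓ : ℓ < 1 * gfmSmibQoriaV4.toGridSMIB.PM * vtGap gfmSmibQoriaV4_δs)
    {δ ω : ℝ → ℝ} (h : gfmSmibQoriaV4.IsSolution δ ω) (h0P : |δ 0 + gfmSmibQoriaV4_δs| < π)
    (h0V : lffGain c (δ 0 - gfmSmibQoriaV4_δs) (gfmSmibQoriaV4.ωb * (ω 0 - gfmSmibQoriaV4.ωe)) ≤ ℓ) :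
    (∀ t, 0 ≤ t → |δ t + gfmSmibQoriaV4_δs| < π ∧
        lffGain c (δ t - gfmSmibQoriaV4_δs) (gfmSmibQoriaV4.ωb * (ω t - gfmSmibQoriaV4.ωe)) ≤ ℓ) ∧
      Tendsto (fun t => (δ t, gfmSmibQoriaV4.ωb * (ω t - gfmSmibQoriaV4.ωe))) atTop
        (𝓝 (gfmSmibQoriaV4_δs, 0)) := by
  have hx : gfmSmibQoriaV4.toGridSMIB.IsSolutionOn
      (fun t => gfmSmibQoriaV4.toGridState (δ t, ω t)) (Ici 0) :=
    gfmSmibQoriaV4.isSolutionOn_toGridSMIB ωb_ne_zero ki_ne_zero ωc_ne_zero ωset_eq h (Ici 0)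
  have h0V' := h0V
  rw [← lffGain_eq_certificate hc hc33 (δ 0, gfmSmibQoriaV4.ωb * (ω 0 - gfmSmibQoriaV4.ωe))] at h0V'
  have key := gfmSmibQoriaV4.toGridSMIB.lff_roa toGridSMIB_M_pos toGridSMIB_D_pos toGridSMIB_PM_pos
    toGridSMIB_PC toGridSMIB_γ abs_δs_lt isEquilibrium_toGridSMIB hc one_pos (weight_lt hc33) hℓ hx
    (by simpa [ReducedParams.toGridState] using h0P) (by simpa [ReducedParams.toGridState] using h0V')
  obtain ⟨hstay, hlim⟩ := key
  refine ⟨fun t ht => ⟨by simpa [ReducedParams.toGridState] using (hstay t ht).1, ?_⟩, ?_⟩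
  · have h2 := (hstay t ht).2
    rw [lffGain_eq_certificate hc hc33] at h2
    simpa [ReducedParams.toGridState] using h2
  · simpa [ReducedParams.toGridState] using hlim

/-- **Corollary in the converter's per-unit frequency**: `δ t → δ^s` and `ω t → ω_e` (= 1 p.u.).
MODELLED: MV-6D + MV-P + MV-Ω. [folklore] -/
theorem lff_freq_tendsto {c : ℝ} (hc : 0 < c) (hc33 : c < 33) {ℓ : ℝ}
    (hℓ : ℓ < 1 * gfmSmibQoriaV4.toGridSMIB.PM * vtGap gfmSmibQoriaV4_δs)
    {δ ω : ℝ → ℝ} (h : gfmSmibQoriaV4.IsSolution δ ω) (h0P : |δ 0 + gfmSmibQoriaV4_δs| < π)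
    (h0V : lffGain c (δ 0 - gfmSmibQoriaV4_δs) (gfmSmibQoriaV4.ωb * (ω 0 - gfmSmibQoriaV4.ωe)) ≤ ℓ) :
    Tendsto δ atTop (𝓝 gfmSmibQoriaV4_δs) ∧ Tendsto ω atTop (𝓝 gfmSmibQoriaV4.ωe) := by
  obtain ⟨-, hlim⟩ := lff_roa hc hc33 hℓ h h0P h0V
  have hδ : Tendsto δ atTop (𝓝 gfmSmibQoriaV4_δs) := by simpa using hlim.fst_nhds
  have hΩ : Tendsto (fun t => gfmSmibQoriaV4.ωb * (ω t - gfmSmibQoriaV4.ωe)) atTop (𝓝 0) := by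
    simpa using hlim.snd_nhds
  refine ⟨hδ, ?_⟩
  have hb := ωb_ne_zero
  have hω' : Tendsto (fun t => gfmSmibQoriaV4.ωb⁻¹ * (gfmSmibQoriaV4.ωb * (ω t - gfmSmibQoriaV4.ωe))
      + gfmSmibQoriaV4.ωe) atTop (𝓝 (gfmSmibQoriaV4.ωb⁻¹ * 0 + gfmSmibQoriaV4.ωe)) :=
    (hΩ.const_mul _).add_const _
  have heq : (fun t => gfmSmibQoriaV4.ωb⁻¹ * (gfmSmibQoriaV4.ωb * (ω t - gfmSmibQoriaV4.ωe))
      + gfmSmibQoriaV4.ωe) = ω := by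
    funext t; field_simp; ring
  rw [heq] at hω'
  simpa using hω'

/-- **The rational-level region** (`ℓ = 649/100`): for every weight `0 < c < 33`, every solution of
the converter model with `|δ(0) + δ^s| < π` and `lffGain c (δ 0 − δ^s) (ω_b′(ω 0 − ω_e)) ≤ 649/100`
keeps `|δ + δ^s| < π`, keeps the gain `≤ 649/100`, and has `δ → δ^s`, `ω → ω_e`. MODELLED: MV-6D +
MV-P + MV-Ω; inner estimate; no stability word. [folklore] -/
theorem lff_roa_649 {c : ℝ} (hc : 0 < c) (hc33 : c < 33) {δ ω : ℝ → ℝ}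
    (h : gfmSmibQoriaV4.IsSolution δ ω) (h0P : |δ 0 + gfmSmibQoriaV4_δs| < π)
    (h0V : lffGain c (δ 0 - gfmSmibQoriaV4_δs) (gfmSmibQoriaV4.ωb * (ω 0 - gfmSmibQoriaV4.ωe)) ≤ 649 / 100) :
    (∀ t, 0 ≤ t → |δ t + gfmSmibQoriaV4_δs| < π ∧
        lffGain c (δ t - gfmSmibQoriaV4_δs) (gfmSmibQoriaV4.ωb * (ω t - gfmSmibQoriaV4.ωe)) ≤ 649 / 100) ∧
      Tendsto δ atTop (𝓝 gfmSmibQoriaV4_δs) ∧ Tendsto ω atTop (𝓝 gfmSmibQoriaV4.ωe) :=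
  ⟨(lff_roa hc hc33 level_649_admissible h h0P h0V).1,
    lff_freq_tendsto hc hc33 level_649_admissible h h0P h0V⟩

end Summit.Ventures.GridStability.Models.InverterDroop.gfmSmibQoriaV4

end
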